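import Literature.Computability.Complexity.SatDHamMachine
import Literature.Computability.Complexity.HamCircuitNP
import HarnessLib

/-!
# Karp's Main Theorem, problem 10: `HAMILTON CIRCUIT` is NP-complete (discharge of `isNPComplete_HAMCIRCUIT`)

Sibling proof file of `KarpProblems.lean` (D-0014: the named fact
`Literature.Computability.Complexity.isNPComplete_HAMCIRCUIT : Prop := IsNPComplete HAMCIRCUIT` stays a `def`;
this file proves `isNPComplete_HAMCIRCUIT_holds`). Karp 1972, §4, Main Theorem: the 21 problems, among
them problem 9 DIRECTED HAMILTON CIRCUIT and problem 10 (UNDIRECTED) HAMILTON CIRCUIT, are NP-complete,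
by the chain of reductions `SATISFIABILITY ∝ … ∝ DIRECTED HAMILTON CIRCUIT ∝ HAMILTON CIRCUIT` and the
remark that all of them are in NP. The tree's proof assembles

* `isNPComplete_kSAT_three_holds` — `3SAT` is NP-complete (Cook–Levin, `ClayProblemProofs.lean`);
* `kSAT_three_karpReducible_DHAMCIRCUIT` — `3SAT ≤ₚ DIRECTED HAMILTON CIRCUIT` by the Arora–Barak
  chain construction (Thm. 2.17, cycle form; `SatDHamMachine.lean`, combinatorics in
  `Combinatorics/SimpleGraph/HamiltonianSatGadget.lean`);
* `DHAMCIRCUIT_karpReducible_HAMCIRCUIT` — Karp's `DIRECTED HAMILTON CIRCUIT ∝ HAMILTON CIRCUIT`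
  (Sipser Thm. 7.55 splitting; `DirectedHamiltonCircuit.lean`);
* `HAMCIRCUIT_mem_NP` — the vertex-list verifier (`HamCircuitNP.lean`);

by transitivity of `≤ₚ` and propagation of completeness along reductions
(`PolyTimeKarpReducible.trans_holds`, `IsComplete.of_reducible_holds`, Arora–Barak Thm. 2.8).

## References

* R. M. Karp, *Reducibility among combinatorial problems*, in: R. E. Miller, J. W. Thatcher (eds.),
  Complexity of Computer Computations, Plenum 1972, 85–103, §4 Main Theorem (problems 9, 10).
* S. Arora, B. Barak, *Computational Complexity: A Modern Approach*, CUP 2009, Thm. 2.8, Thm. 2.17,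
  Ex. 2.18.
* M. Sipser, *Introduction to the Theory of Computation*, 3rd ed., 2012, Thm. 7.46, Thm. 7.55.
-/

namespace Literature.Computability.Complexity

open scoped Notation

/-- **`DIRECTED HAMILTON CIRCUIT` is NP-hard** (Karp 1972, problem 9): `3SAT` is NP-complete and
reduces to it. [cite: Karp1972, §4 Main Theorem, problem 9] -/
theorem DHAMCIRCUIT_isNPHard : IsNPHard DHAMCIRCUIT :=
  IsHard.of_reducible_holds isNPComplete_kSAT_three_holds.isHard kSAT_three_karpReducible_DHAMCIRCUIT

/-- **`HAMILTON CIRCUIT` is NP-hard** (Karp 1972, problem 10).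
[cite: Karp1972, §4 Main Theorem, problem 10] -/
theorem HAMCIRCUIT_isNPHard : IsNPHard HAMCIRCUIT :=
  IsHard.of_reducible_holds DHAMCIRCUIT_isNPHard DHAMCIRCUIT_karpReducible_HAMCIRCUIT

/-- **Discharge of `isNPComplete_HAMCIRCUIT`** (Karp 1972, Main Theorem, problem 10): undirected
HAMILTON CIRCUIT is NP-complete — in `NP` by the vertex-list verifier, NP-hard by
`3SAT ≤ₚ DIRECTED HAMILTON CIRCUIT ≤ₚ HAMILTON CIRCUIT`. [cite: Karp1972, §4 Main Theorem, problem 10] -/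
theorem isNPComplete_HAMCIRCUIT_holds : isNPComplete_HAMCIRCUIT :=
  ⟨HAMCIRCUIT_mem_NP, HAMCIRCUIT_isNPHard⟩

end Literature.Computability.Complexity
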